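import Literature.NumberTheory.Transcendental.ZilberSaturation
import Literature.NumberTheory.Transcendental.GammaFieldsEcl
import Literature.NumberTheory.Transcendental.GammaFieldsEclTransfer
import Literature.ModelTheory.Quasiminimal.LocalIsoSystems
import Mathlib.RingTheory.AlgebraicIndependent.Transcendental
import Mathlib.Algebra.MvPolynomial.Equiv
import HarnessLib

/-!
# Quasiminimality of Zilber fields from `ℵ₀`-saturation for exponentially-algebraic extensions

Sibling file of `Literature/NumberTheory/Transcendental/ZilberField.lean` for the named fact
`Literature.NumberTheory.Transcendental.IsZilberField.isQuasiminimal` (B. Zilber, *Pseudo-exponentiation on algebraically closed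
fields of characteristic zero*, Ann. Pure Appl. Logic 132 (2005), Thm 1.2; complete proof:
M. Bays, J. Kirby, Algebra & Number Theory 12 (2018), Thm 9.1): **every Zilber field is
quasiminimal**. Here the statement is *reduced to a single named fact of the literature*,
`Literature.NumberTheory.Transcendental.BaysKirby2018_saturation_of_isStronglyExpAlgClosed` (Bays–Kirby 2018, Lemma 8.3:
strong exponential-algebraic closedness makes a Zilber field `ℵ₀`-saturated for finitely
generated exponentially-algebraic strong extensions), everything else being proved:

* `Literature.IsZilberField.isQuasiminimal_of_saturation :
    BaysKirby2018_saturation_of_isStronglyExpAlgClosed.{u} → IsZilberField.isQuasiminimal.{u}`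
  (any universe; the Γ-closedness of `ecl c` for finite `c` — Kirby 2010 Thm 1.2, proved in the
  tree for fields in `Type` from Ax's theorem — is supplied in all universes by
  `GammaFieldsEclTransfer.lean`, `Literature.NumberTheory.Transcendental.GammaField.isGammaClosed_span_ecl_of_countable`).

## The argument (Zilber 2005 §5; Bays–Kirby 2013 §3; Kirby 2010, Lemma 5.1)

A subset `S = φ(F, b)` of an uncountable Zilber field `F` definable over the finite tuple `b`
contains all or no elements outside a countable set, because any two such elements `a, c` are
matched, over `b`, by a member of a *back-and-forth system of local isomorphisms* of `F`
(`FirstOrder.Language.IsLocalIsoSystem`, file `Literature/ModelTheory/Quasiminimal/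
LocalIsoSystems.lean`, whose members preserve all first-order formulas by Karp's lemma). The
system used here (`Literature.ZilberHomogeneity.HullIsoRel τ`, `ker exp = τℤ`): `x ~ y` iff `x`, `y`
extend to finite tuples `(x, u)`, `(y, v)` which together with `τ` span *strong* subspaces
(`GammaField.IsStrong`, Bays–Kirby 2018 Def. 4.3: all finitely generated extensions have
predimension `δ = td - ldim ≥ 0`) and which are *Γ-isomorphic over `ℚτ`*
(`GammaField.IsGammaIso`, `ZilberSaturation.lean`: the exponential fields generated over
`ℚ^{ab}(τ)` by the tuples and all their division points `exp (w/m)` are isomorphic via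
`(x, u) ↦ (y, v)`). Then:

* restriction to sub-tuples, symmetry and preservation of the unnested atomic facts
  `xᵢ = xⱼ + xₗ`, `xᵢ = xⱼ xₗ`, `xᵢ = exp xⱼ`, … are immediate (`HullIsoRel.comp`,
  `HullIsoRel.funMap_eq`: level `0` of the Γ-isomorphism);
* **forth over an element `a` which is Γ-algebraic over the strong subspace `X` spanned by
  `τ, x, u`** (`a` lies in a finite tuple `z` with `δ(z/X) = 0`, `IsGammaAlgebraic`): `X + ℚz` is
  a finitely generated Γ-algebraic strong extension of `X`, and the named fact embeds it over the
  Γ-isomorphic copy `ℚτ + ℚy + ℚv` (`forth_of_isGammaAlgebraic`);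
* **forth over any other `a`**: then `a ∉ X`, `δ(a/X) = 1`, `X + ℚa ◁ F` and
  `td(a, exp a/X) = 2` (`isStrong_sup_of_not_isGammaAlgebraic`); on the other side pick `b`
  outside the countable (CCP) Γ-closed set `ecl(y, v)` (`F` is uncountable), so that
  `ℚτ + ℚy + ℚv + ℚb ◁ F` and `td(b, exp b/…) = 2` by Bays–Kirby 2018 Lemma 4.13
  (`GammaField.IsStrong.sup_span_singleton`), and extend the Γ-isomorphism by `a ↦ b`
  (`GammaField.IsGammaIso.append_singleton`: **uniqueness of the type of a generic element** —
  at every level the relation ideal of `(c, a, exp (c/M!), exp (a/M!))` is generated by that of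
  `(c, exp (c/M!))` because `(a, exp (a/M!))` is algebraically independent over the level algebra,
  `ZilberHomogeneity.ker_aeval_sumElim_eq`);
* **all elements outside a countable set correspond over `b`** (`exists_countable_generic`):
  extend `(τ, b)` to a tuple spanning a strong subspace (a hull; hulls exist over the zero
  subspace, which is strong by the Schanuel property, `isStrong_bot_of_schanuelProperty`), and
  for `a, c ∉ ecl(b, u)` extend the identity Γ-isomorphism by `a ↦ c` as above;
* assembly: `IsLocalIsoSystem.countable_or_countable_compl` (a countable `F` is trivially
  quasiminimal).

This is the `G = ∅` ("over finitely generated strong subspaces") case of the `ℵ₀`-homogeneity of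
Bays–Kirby 2013, proof of Prop. 5, which is all that quasiminimality requires; the homogeneity
over countable *closed* sets `G` needed for categoricity (Kirby 2010, Thm 2.1; vendored as
`Literature.NumberTheory.Transcendental.IsZilberField.eclIso_extension` in `ZilberFieldQuasiminimal.lean`) is not used.

## Contents

* `Literature.NumberTheory.Transcendental.BaysKirby2018_saturation_of_isStronglyExpAlgClosed` — NAMED FACT (Bays–Kirby 2018,
  Lemma 8.3 with Def. 5.14, setting of Thm 9.1).
* `Literature.NumberTheory.Transcendental.Kirby2010_isGammaClosed_ecl` — named fact (all `ecl C` Γ-closed, any universe), **proved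
  for fields in `Type`** (`Literature.NumberTheory.Transcendental.Kirby2010_isGammaClosed_ecl_holds₀`); only its countable case
  (a theorem, `GammaFieldsEclTransfer.lean`) is used.
* `Literature.NumberTheory.Transcendental.ZilberHomogeneity.ker_aeval_sumElim_eq`, `….aeval_sumElim_eq_zero_iff` — relation ideals of
  families extended by algebraically independent families (pure algebra, proved).
* `Literature.NumberTheory.Transcendental.ZilberHomogeneity.mem_acl_of_isAlgebraic`, `….transcendental_of_not_mem_acl`,
  `….algebraicIndependent_lvGens_singleton`, `Literature.NumberTheory.Transcendental.GammaField.IsGammaIso.append_singleton`,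
  `Literature.NumberTheory.Transcendental.GammaField.IsGammaIso.comp` — proved.
* `Literature.NumberTheory.Transcendental.ZilberHomogeneity.natCast_le_eRk_of_le_trdeg`, `….isStrong_bot_of_schanuelProperty` —
  the Schanuel property as strongness of the zero subspace (proved).
* `Literature.NumberTheory.Transcendental.ZilberHomogeneity.HullIsoRel` and its API, `….isLocalIsoSystem_hullIsoRel`,
  `….exists_countable_generic` — proved (from the two named facts).
* `Literature.NumberTheory.Transcendental.IsZilberField.isQuasiminimal_of_saturation` (and the variants
  `…_of_saturation_of_isGammaClosed`, `isQuasiminimal₀_of_saturation`) — the reduction (proved).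

## Faithfulness notes

* The base of all Γ-isomorphisms is `ℚτ` (`fieldOf (span {τ}) = ℚ(ℚτ, exp ℚτ) = ℚ^{ab}(τ)`),
  Bays–Kirby's `F_base = SK` for pseudo-exponentiation (2018, §9.1); Γ-isomorphisms over it fix
  `τ` and all roots of unity, as the isomorphisms "over `A ⊇ F_base`" of Def. 5.14 do. With this
  base, axiom 4 of Thm 9.1 (`x̄` `ℚ`-linearly independent over `ā`) is exactly what Lemma 8.3
  consumes, and it follows from the tree's `IsStronglyExpAlgClosed`.
* `Language.expRing.IsQuasiminimal F` is quasiminimality of `⟨F; +, ·, exp⟩` as in Zilber 2005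
  Thm 1.2 and Bays–Kirby 2018 Thm 9.1; no expanded language is used (the Karp argument of
  `LocalIsoSystems.lean` unnests terms inside `Language.expRing`).
* Remaining work towards `IsZilberField.isQuasiminimal_holds`: prove
  `BaysKirby2018_saturation_of_isStronglyExpAlgClosed` (good bases / Kummer genericity,
  Bays–Kirby 2018 §3 and Lemma 8.3).

## References

* B. Zilber, *Pseudo-exponentiation on algebraically closed fields of characteristic zero*,
  Ann. Pure Appl. Logic 132 (2005) 67–95: Thm 1.2, §5.
* M. Bays, J. Kirby, *Pseudo-exponential maps, variants, and quasiminimality*, Algebra & Number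
  Theory 12 (2018) 493–549, arXiv:1512.04262: Def. 4.3, Def. 4.6, Lemma 4.13, Def. 5.11,
  Def. 5.14, Lemma 8.3, Thm 9.1, Remark 10.10.
* M. Bays, J. Kirby, *Excellence and uncountable categoricity of Zilber's exponential fields*,
  arXiv:1305.0493 (2013): Lemma 3, Prop. 5 (proof).
* J. Kirby, *On quasiminimal excellent classes*, J. Symbolic Logic 75 (2010) 551–564: Lemma 5.1.
* J. Kirby, *Exponential algebraicity in exponential fields*, Bull. LMS 42 (2010) 879–890: Thm 1.2.
* M. Bays, B. Hart, T. Hyttinen, M. Kesälä, J. Kirby, *Quasiminimal structures and excellence*,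
  Bull. LMS 46 (2014) 155–163: Lemma 2.2, Prop. 7.1.
-/

noncomputable section


open Set MvPolynomial

namespace Literature.NumberTheory.Transcendental

namespace ZilberHomogeneity

/-! ### Relation ideals of a family extended by an algebraically independent family -/

section KerSumElim

variable {R A : Type*} [CommRing R] [CommRing A] [Algebra R A] {ι κ : Type*}

variable (R) in
/-- The `R`-algebra map `R[X_ι] → R[v]` onto the subalgebra generated by `v`. [folklore] -/
def aevalCod (v : ι → A) : MvPolynomial ι R →ₐ[R] Algebra.adjoin R (range v) :=
  (aeval v).codRestrict (Algebra.adjoin R (range v)) fun P => by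
    rw [Algebra.adjoin_range_eq_range_aeval]; exact ⟨P, rfl⟩

/-- `aevalCod v P` is `P(v)`. [folklore] -/
@[simp] theorem coe_aevalCod (v : ι → A) (P : MvPolynomial ι R) :
    (aevalCod R v P : A) = aeval v P := rfl

/-- **Evaluation at `(p, v)` in two steps**: view `P ∈ R[X_κ, X_ι]` as a polynomial in the
`κ`-variables with coefficients in `R[X_ι]`, push the coefficients into `R[v] ⊆ A`, and evaluate
at `p` over `R[v]`. [folklore] -/
theorem aeval_sumElim_eq (p : κ → A) (v : ι → A) (P : MvPolynomial (κ ⊕ ι) R) :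
    aeval (Sum.elim p v) P =
      aeval (R := Algebra.adjoin R (range v)) p
        (MvPolynomial.map (aevalCod R v).toRingHom (sumAlgEquiv R κ ι P)) := by
  set S := Algebra.adjoin R (range v)
  let ψ : MvPolynomial (κ ⊕ ι) R →ₐ[R] A :=
    ((aeval (R := S) p).restrictScalars R).comp
      ((mapAlgHom (aevalCod R v)).comp (sumAlgEquiv R κ ι : MvPolynomial (κ ⊕ ι) R →ₐ[R] _))
  have hψ : ψ = aeval (Sum.elim p v) := by
    refine MvPolynomial.algHom_ext fun s => ?_
    rcases s with k | i
    · simp [ψ]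
    · simp only [ψ, AlgHom.coe_comp, AlgHom.coe_restrictScalars', Function.comp_apply,
        AlgEquiv.coe_toAlgHom, sumAlgEquiv_X_inr, mapAlgHom_apply, map_C, aeval_C, aeval_X,
        Sum.elim_inr]
      show ((aevalCod R v (X i) : S) : A) = v i
      rw [coe_aevalCod, aeval_X]
  have := congrArg (fun φ : MvPolynomial (κ ⊕ ι) R →ₐ[R] A => φ P) hψ
  simpa [ψ] using this.symm

/-- **Vanishing at `(p, v)` with `p` algebraically independent over `R[v]`**: `P(p, v) = 0` iff
every `R[X_ι]`-coefficient of `P` (as a polynomial in the `κ`-variables) vanishes at `v`.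
[folklore] -/
theorem aeval_sumElim_eq_zero_iff {p : κ → A} {v : ι → A}
    (hp : AlgebraicIndependent (Algebra.adjoin R (range v)) p) (P : MvPolynomial (κ ⊕ ι) R) :
    aeval (Sum.elim p v) P = 0 ↔ ∀ m, aeval v ((sumAlgEquiv R κ ι P).coeff m) = 0 := by
  rw [aeval_sumElim_eq, ← map_zero (aeval (R := Algebra.adjoin R (range v)) p),
    (algebraicIndependent_iff_injective_aeval.1 hp).eq_iff, MvPolynomial.ext_iff]
  refine forall_congr' fun m => ?_
  rw [coeff_map, coeff_zero, ← ZeroMemClass.coe_eq_zero]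
  rfl

/-- **Equal relation ideals extend along algebraically independent families.** If `v` and `w`
satisfy the same polynomial relations over `R`, `p` is algebraically independent over `R[v]`
and `q` over `R[w]`, then `(p, v)` and `(q, w)` satisfy the same polynomial relations over `R`
(both relation ideals are generated by that of `v`, resp. `w`). [folklore] -/
theorem ker_aeval_sumElim_eq {p q : κ → A} {v w : ι → A}
    (hvw : RingHom.ker (aeval v : MvPolynomial ι R →ₐ[R] A) =
      RingHom.ker (aeval w : MvPolynomial ι R →ₐ[R] A))
    (hp : AlgebraicIndependent (Algebra.adjoin R (range v)) p)
    (hq : AlgebraicIndependent (Algebra.adjoin R (range w)) q) :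
    RingHom.ker (aeval (Sum.elim p v) : MvPolynomial (κ ⊕ ι) R →ₐ[R] A) =
      RingHom.ker (aeval (Sum.elim q w) : MvPolynomial (κ ⊕ ι) R →ₐ[R] A) := by
  ext P
  rw [RingHom.mem_ker, RingHom.mem_ker, aeval_sumElim_eq_zero_iff hp,
    aeval_sumElim_eq_zero_iff hq]
  refine forall_congr' fun m => ?_
  rw [← RingHom.mem_ker, ← RingHom.mem_ker]
  exact ⟨fun h => hvw ▸ h, fun h => hvw.symm ▸ h⟩

/-- Relation ideals are transported along re-indexing: if `v` and `w` satisfy the same relations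
then so do `v ∘ σ` and `w ∘ σ`. [folklore] -/
theorem ker_aeval_comp_eq {β : Type*} {v w : ι → A}
    (hvw : RingHom.ker (aeval v : MvPolynomial ι R →ₐ[R] A) =
      RingHom.ker (aeval w : MvPolynomial ι R →ₐ[R] A)) (σ : β → ι) :
    RingHom.ker (aeval (v ∘ σ) : MvPolynomial β R →ₐ[R] A) =
      RingHom.ker (aeval (w ∘ σ) : MvPolynomial β R →ₐ[R] A) := by
  ext P
  have h1 : aeval (v ∘ σ) P = aeval v (rename σ P) := (aeval_rename σ v P).symm
  have h2 : aeval (w ∘ σ) P = aeval w (rename σ P) := (aeval_rename σ w P).symm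
  rw [RingHom.mem_ker, RingHom.mem_ker, h1, h2, ← RingHom.mem_ker, ← RingHom.mem_ker, hvw]

end KerSumElim

end ZilberHomogeneity

end Literature.NumberTheory.Transcendental


open Set MvPolynomial

namespace Literature.NumberTheory.Transcendental

namespace ZilberHomogeneity

open GammaField Literature.ModelTheory.ExponentialFields.ExponentialRing

/-! ### From the algebraic matroid to transcendence over subalgebras -/

section AclBridge

variable {F : Type*} [Field F] [CharZero F]

/-- An element algebraic over a subalgebra `S ≤ F` lies in the relative algebraic closure
`acl S` of its carrier. [folklore] -/
theorem mem_acl_of_isAlgebraic {k : Type*} [CommRing k] [Algebra k F] (S : Subalgebra k F)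
    {t : F} (ht : IsAlgebraic S t) : t ∈ acl (S : Set F) := by
  rw [mem_acl_iff]
  obtain ⟨P, hP0, hPt⟩ := ht
  let φ : S →+* Algebra.adjoin ℚ (S : Set F) :=
    (S.val : S →+* F).codRestrict (Algebra.adjoin ℚ (S : Set F)) fun x =>
      Algebra.subset_adjoin x.2
  have hφ : Function.Injective φ := fun a b hab =>
    Subtype.ext (congrArg Subtype.val hab : ((φ a : _) : F) = φ b)
  refine ⟨P.map φ, fun h0 => hP0 (Polynomial.map_injective φ hφ (by rw [h0, Polynomial.map_zero])),
    ?_⟩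
  rw [Polynomial.aeval_def, Polynomial.eval₂_map]
  have : (algebraMap (Algebra.adjoin ℚ (S : Set F)) F).comp φ = algebraMap S F := by
    ext x; rfl
  rw [this, ← Polynomial.aeval_def, hPt]

/-- If the carrier of a subalgebra `S` lies in `acl s` and `t ∉ acl s` then `t` is transcendental
over `S`. [folklore] -/
theorem transcendental_of_not_mem_acl {k : Type*} [CommRing k] [Algebra k F] (S : Subalgebra k F)
    {s : Set F} (hS : (S : Set F) ⊆ acl s) {t : F} (ht : t ∉ acl s) : Transcendental S t :=
  fun h => ht (acl_subset_acl_of_subset hS (mem_acl_of_isAlgebraic S h))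

/-- A subalgebra generated over a base inside `acl s` by elements of `acl s` lies in `acl s`.
[folklore] -/
theorem algebraAdjoin_subset_acl {k : Type*} [CommRing k] [Algebra k F] {s g : Set F}
    (hk : ∀ r : k, algebraMap k F r ∈ acl s) (hg : g ⊆ acl s) :
    ((Algebra.adjoin k g : Subalgebra k F) : Set F) ⊆ acl s := by
  intro x hx
  induction hx using Algebra.adjoin_induction with
  | mem x hx => exact hg hx
  | algebraMap r => exact hk r
  | add x y _ _ hx hy => exact add_mem_acl hx hy
  | mul x y _ _ hx hy => exact mul_mem_acl hx hy

end AclBridge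

/-! ### Extending a Γ-isomorphism by a generic element -/

section GenericExt

variable {F : Type*} [Field F] [CharZero F] [Literature.ModelTheory.ExponentialFields.ExponentialRing F]
variable {K : Submodule ℚ F} {N : ℕ}

/-- The level-`M` algebra `K₀[c, exp (c/M!)]` lies in `acl (gens (K + ℚc))`. [folklore] -/
theorem coe_lvAlgebra_subset_acl (K : Submodule ℚ F) (M : ℕ) (c : Fin N → F) :
    ((lvAlgebra K M c : Subalgebra (fieldOf K) F) : Set F) ⊆
      acl (gens (K ⊔ Submodule.span ℚ (range c))) := by
  refine algebraAdjoin_subset_acl (fun r => ?_) ?_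
  · exact acl_mono (gens_mono le_sup_left) (fieldOf_subset_acl K r.2)
  · rintro _ ⟨j, rfl⟩
    exact subset_acl _ (lvGens_mem_gens K M c j)

/-- **The division points of a generic element are algebraically independent over every level
algebra**: if `td(d, exp d / K + ℚc) = 2` then `(d, exp (d/M!))` is algebraically independent
over `K₀[c, exp (c/M!)]`. [folklore] -/
theorem algebraicIndependent_lvGens_singleton (K : Submodule ℚ F) (M : ℕ) (c : Fin N → F)
    {d : F} (hd : td (K ⊔ Submodule.span ℚ (range c)) (Submodule.span ℚ {d}) = 2) :
    AlgebraicIndependent (lvAlgebra K M c) (lvGens M ![d]) := by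
  set X := K ⊔ Submodule.span ℚ (range c) with hX
  set S : Subalgebra (fieldOf K) F := lvAlgebra K M c with hS
  obtain ⟨hd1, hd2⟩ := not_mem_acl_of_td_eq_two hd
  have hSacl : (S : Set F) ⊆ acl (gens X) := coe_lvAlgebra_subset_acl K M c
  -- `d` is transcendental over `S`
  have h1 : Transcendental S d := transcendental_of_not_mem_acl S hSacl hd1
  -- `exp (d/M!)` is transcendental over `S[d]`
  have hT : ((Algebra.adjoin S (range ![d]) : Subalgebra S F) : Set F) ⊆
      acl (insert d (gens X)) := by
    refine algebraAdjoin_subset_acl (fun r => acl_mono (subset_insert _ _) (hSacl r.2)) ?_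
    rintro _ ⟨i, rfl⟩
    exact subset_acl _ (by simp)
  have h2 : Transcendental (Algebra.adjoin S (range ![d])) (exp (d / (M.factorial : F))) := by
    refine transcendental_of_not_mem_acl _ hT fun hmem => hd2 ?_
    have hpow : exp (d / (M.factorial : F)) ^ M.factorial = exp d := by
      have := exp_div_factorial_eq_pow d (Nat.zero_le M)
      simpa using this.symm
    rw [← hpow]
    exact pow_mem_acl' hmem
  have h3 : AlgebraicIndependent S (fun o : Option (Fin 1) => o.elim (exp (d / (M.factorial : F))) ![d]) :=
    AlgebraicIndependent.option_iff.2 ⟨algebraicIndependent_iff_transcendental.2 h1, h2⟩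
  -- re-index
  let e : Fin 1 ⊕ Fin 1 → Option (Fin 1) := Sum.elim some fun _ => none
  have he : Function.Injective e := by
    rintro (i | i) (j | j) h
    · simpa [e] using h
    · simp [e] at h
    · simp [e] at h
    · simp [Subsingleton.elim i j]
  have hcomp : lvGens M ![d] =
      (fun o : Option (Fin 1) => o.elim (exp (d / (M.factorial : F))) ![d]) ∘ e := by
    funext s
    rcases s with i | i
    · simp [e, lvGens]
    · simp [e, lvGens, Subsingleton.elim i 0]
  rw [hcomp]
  exact h3.comp e he
  where
  /-- powers stay in `acl` -/
  pow_mem_acl' {s : Set F} {a : F} (ha : a ∈ acl s) : ∀ {n : ℕ}, a ^ n ∈ acl s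
    | 0 => by rw [pow_zero]; exact one_mem_acl s
    | n + 1 => by rw [pow_succ]; exact mul_mem_acl (pow_mem_acl' ha) ha

/-- The index map presenting `(c, d; exp ((c, d)/M!))` as a re-indexing of
`((d; exp (d/M!)), (c; exp (c/M!)))`. [folklore] -/
def appendIdx (N : ℕ) : Fin (N + 1) ⊕ Fin (N + 1) → (Fin 1 ⊕ Fin 1) ⊕ (Fin N ⊕ Fin N) :=
  Sum.elim (Fin.addCases (fun i => Sum.inr (Sum.inl i)) fun i => Sum.inl (Sum.inl i))
    (Fin.addCases (fun i => Sum.inr (Sum.inr i)) fun i => Sum.inl (Sum.inr i))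

omit [CharZero F] in
/-- The level generators of `(c, d)` are those of `d` and of `c`, re-indexed. [folklore] -/
theorem lvGens_append_singleton (M : ℕ) (c : Fin N → F) (d : F) :
    lvGens M (Fin.append c ![d]) = Sum.elim (lvGens M ![d]) (lvGens M c) ∘ appendIdx N := by
  funext s
  rcases s with j | j
  · refine Fin.addCases (fun i => ?_) (fun i => ?_) j
    · simp [appendIdx, lvGens]
    · simp [appendIdx, lvGens]
  · refine Fin.addCases (fun i => ?_) (fun i => ?_) j
    · simp [appendIdx, lvGens]
    · simp [appendIdx, lvGens]

/-- **Extension of a Γ-isomorphism over `K` by a generic element.** If `c ↦ c'` is a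
Γ-isomorphism over `K` and `d`, `d'` are generic over `K + ℚc`, `K + ℚc'` respectively
(`td(d, exp d/K + ℚc) = 2`, i.e. `d` and `exp d` algebraically independent over the Γ-field of
`K + ℚc`), then `(c, d) ↦ (c', d')` is a Γ-isomorphism over `K`: at each level `M`, the relation
ideal of `(c, d, exp (c/M!), exp (d/M!))` is generated by that of `(c, exp (c/M!))`, because the
division points `(d, exp (d/M!))` are algebraically independent over the level algebra.
(The uniqueness of the type of a generic element over a strong subspace: Kirby 2010, quasiminimal
excellent classes, axiom II(i), for Zilber fields — Bays–Kirby 2013, proof of Prop. 5 (i).)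
[cite: BaysKirby2013Excellence, Prop. 5 (i) (proof)] -/
theorem _root_.Literature.NumberTheory.Transcendental.GammaField.IsGammaIso.append_singleton {c c' : Fin N → F} (h : IsGammaIso K c c') {d d' : F}
    (hd : td (K ⊔ Submodule.span ℚ (range c)) (Submodule.span ℚ {d}) = 2)
    (hd' : td (K ⊔ Submodule.span ℚ (range c')) (Submodule.span ℚ {d'}) = 2) :
    IsGammaIso K (Fin.append c ![d]) (Fin.append c' ![d']) := by
  rw [isGammaIso_iff_ker_eq] at h ⊢
  intro M
  have key := ker_aeval_sumElim_eq (h M) (algebraicIndependent_lvGens_singleton K M c hd)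
    (algebraicIndependent_lvGens_singleton K M c' hd')
  rw [lvGens_append_singleton, lvGens_append_singleton]
  exact ker_aeval_comp_eq key (appendIdx N)

end GenericExt

end ZilberHomogeneity

end Literature.NumberTheory.Transcendental


open Set Cardinal

namespace Literature.NumberTheory.Transcendental

namespace ZilberHomogeneity

open GammaField Literature.ModelTheory.ExponentialFields.ExponentialRing Matroid

/-! ### The Schanuel property makes the zero subspace strong -/

section SchanuelStrong

variable {F : Type*} [Field F] [CharZero F] [Literature.ModelTheory.ExponentialFields.ExponentialRing F]

omit [Literature.ModelTheory.ExponentialFields.ExponentialRing F] in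
/-- **`Algebra.trdeg` over `ℚ` versus rank in the algebraic matroid**: if `ℚ(T)` has
transcendence degree at least `n` over `ℚ` then `T` has rank at least `n` (a `ℚ`-algebraically
independent subset of `ℚ(T)` is independent and lies in the closure of `T`). [folklore] -/
theorem natCast_le_eRk_of_le_trdeg {T : Set F} {n : ℕ}
    (h : (n : Cardinal) ≤ Algebra.trdeg ℚ ↥(IntermediateField.adjoin ℚ T)) :
    (n : ℕ∞) ≤ (algMatroid F).eRk T := by
  classical
  set M := algMatroid F
  set E₁ : IntermediateField ℚ F := IntermediateField.adjoin ℚ T with hE₁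
  by_contra hlt
  push Not at hlt
  obtain ⟨k, hk⟩ := ENat.ne_top_iff_exists.1 hlt.ne_top
  have hkn : k < n := by
    rw [← hk] at hlt
    exact_mod_cast hlt
  have key : ∀ s : {s : Set E₁ // AlgebraicIndepOn ℚ _root_.id s}, #s.1 ≤ (k : Cardinal) := by
    rintro ⟨s, hs⟩
    set I : Set F := ((↑) : E₁ → F) '' s with hIdef
    have hI : AlgebraicIndepOn ℚ id I := by
      have h1 : AlgebraicIndependent ℚ (E₁.val ∘ ((↑) : s → E₁)) :=
        hs.map' (f := E₁.val) (RingHom.injective _)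
      have h2 := h1.to_subtype_range
      have hr : range (E₁.val ∘ ((↑) : s → E₁)) = I := by
        rw [range_comp, Subtype.range_coe]; rfl
      rw [hr] at h2
      exact h2
    have hind : M.Indep I := AlgebraicIndependent.matroid_indep_iff.2 hI
    have hIS : I ⊆ M.closure T := by
      rintro _ ⟨a, _, rfl⟩
      exact adjoin_subset_acl T a.2
    have h1 : M.eRk I ≤ k := by
      rw [hk, ← M.eRk_closure_eq T]
      exact M.eRk_mono hIS
    have h2 : M.eRk I = I.encard := hind.eRk_eq_encard
    have h4 : toENat #I ≤ k := by rw [Set.toENat_cardinalMk, ← h2]; exact h1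
    have h5 : #I < ℵ₀ := by
      rw [← Cardinal.toENat_ne_top]
      exact ne_top_of_le_ne_top (ENat.coe_ne_top k) h4
    obtain ⟨m, hm⟩ := Cardinal.lt_aleph0.1 h5
    have h6 : m ≤ k := by
      rw [hm, map_natCast] at h4; exact_mod_cast h4
    calc #s = #I := (Cardinal.mk_image_eq Subtype.val_injective).symm
      _ = m := hm
      _ ≤ k := by exact_mod_cast h6
  have htr : Algebra.trdeg ℚ E₁ ≤ (k : Cardinal) := ciSup_le' key
  have : (n : Cardinal) ≤ k := h.trans htr
  have : n ≤ k := by exact_mod_cast this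
  omega

/-- The generators `{0, exp 0}` of the Γ-subfield of the zero subspace are algebraic: the closure
of `gens ⊥` in the algebraic matroid is that of `∅`. [folklore] -/
theorem closure_gens_bot :
    (algMatroid F).closure (gens (⊥ : Submodule ℚ F)) = (algMatroid F).closure ∅ := by
  refine Subset.antisymm ((algMatroid F).closure_subset_closure_of_subset_closure ?_)
    ((algMatroid F).closure_subset_closure (empty_subset _))
  rintro a (ha | ⟨b, hb, rfl⟩)
  · have : a = 0 := (Submodule.mem_bot ℚ).1 ha
    rw [this]; exact zero_mem_acl _
  · have : b = 0 := (Submodule.mem_bot ℚ).1 hb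
    rw [this, exp_zero]; exact one_mem_acl _

/-- `td(Λ'/0)` is the rank of `gens Λ'` in the algebraic matroid. [folklore] -/
theorem td_bot (Λ' : Submodule ℚ F) : td ⊥ Λ' = (algMatroid F).eRk (gens Λ') := by
  rw [td_def, (algMatroid F).relRank_congr_closure_left (gens Λ') closure_gens_bot,
    relRank_eq_eRk_contract, contract_empty]

/-- **The Schanuel property is strongness of the zero subspace** (Bays–Kirby 2018, §9.1, proof of
Thm 9.1: "the predimension inequality is precisely Schanuel's conjecture"; Zilber 2005 §1 (SP)):
if `F` has the Schanuel property then `δ(x̄/∅) ≥ 0` for every finite tuple, i.e. `0 ◁ F` in the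
vocabulary of `GammaFields.lean`. [cite: BaysKirby2018ANT, Thm 9.1 (proof)] -/
theorem isStrong_bot_of_schanuelProperty (hSP : Literature.ModelTheory.ExponentialFields.SchanuelProperty F) :
    IsStrong (⊥ : Submodule ℚ F) := by
  classical
  intro Λ' _ hfg
  haveI := hfg.finite
  set n := ldim (⊥ : Submodule ℚ F) Λ' with hn
  let b := Module.finBasis ℚ ↥(Λ'.map (⊥ : Submodule ℚ F).mkQ)
  have hcard : Module.finrank ℚ ↥(Λ'.map (⊥ : Submodule ℚ F).mkQ) = n := rfl
  have hmem : ∀ i : Fin n, ∃ y ∈ Λ', (⊥ : Submodule ℚ F).mkQ y =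
      (b (Fin.cast hcard.symm i) : F ⧸ (⊥ : Submodule ℚ F)) := fun i =>
    Submodule.mem_map.1 (b (Fin.cast hcard.symm i)).2
  choose x hxΛ' hxb using hmem
  have hx : LinearIndependent ℚ ((⊥ : Submodule ℚ F).mkQ ∘ x) := by
    have hb : LinearIndependent ℚ
        (fun i : Fin n => ((b (Fin.cast hcard.symm i) : ↥(Λ'.map (⊥ : Submodule ℚ F).mkQ)) :
          F ⧸ (⊥ : Submodule ℚ F))) :=
      (b.linearIndependent.map' (Λ'.map (⊥ : Submodule ℚ F).mkQ).subtype
        (Submodule.ker_subtype _)).comp _ (Fin.cast_injective _)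
    convert hb using 1
    funext i
    exact hxb i
  have hx' : LinearIndependent ℚ x := LinearIndependent.of_comp _ hx
  have h1 : (n : ℕ∞) ≤ (algMatroid F).eRk (range x ∪ range (exp ∘ x)) :=
    natCast_le_eRk_of_le_trdeg (hSP n x hx')
  have h2 : (algMatroid F).eRk (range x ∪ range (exp ∘ x)) ≤ td ⊥ Λ' := by
    rw [td_bot]
    refine (algMatroid F).eRk_mono ?_
    rintro a (⟨i, rfl⟩ | ⟨i, rfl⟩)
    · exact mem_gens_of_mem (hxΛ' i)
    · exact exp_mem_gens (hxΛ' i)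
  have hne : td ⊥ Λ' ≠ ⊤ := td_ne_top hfg
  have h3 : n ≤ (td ⊥ Λ').toNat := by
    have := h1.trans h2
    rw [← ENat.coe_toNat hne] at this
    exact_mod_cast this
  have h4 : predim ⊥ Λ' = ((td ⊥ Λ').toNat : ℤ) - (n : ℤ) := rfl
  omega

end SchanuelStrong

end ZilberHomogeneity

end Literature.NumberTheory.Transcendental


open Set

universe u

namespace Literature.NumberTheory.Transcendental

open GammaField Literature.ModelTheory.ExponentialFields.ExponentialRing

/-! ### The named facts -/

/-- NAMED FACT — **`ℵ₀`-saturation of Zilber fields for finitely generated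
exponentially-algebraic strong extensions** (Bays–Kirby 2018, Lemma 8.3, direction "axioms 1–4
⟹ `ℵ₀`-saturated for Γ-algebraic extensions", Def. 5.14, in the setting of Thm 9.1:
`k = ℚ`, `G = 𝔾ₐ × 𝔾ₘ`, `𝒪 = ℤ`, base `F_base = ℚ^{ab}(τ)` with `Γ(F_base)` the graph of
`exp` on `ℚτ`, `ker exp = τℤ` — "this `F_base` is called SK in [FPEF]").
Let `F` be an exponential field satisfying axioms 1–4 of `ECF_SK` (Thm 9.1): `F` is an
algebraically closed field of characteristic zero with `exp` onto `Fˣ`, `ker exp = τℤ` with `τ`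
transcendental, the Schanuel property, and strong exponential-algebraic closedness (the tree's
`Literature.NumberTheory.Transcendental.IsStronglyExpAlgClosed`, which implies axiom 4 as printed — `x̄` `ℚ`-linearly independent
over `ā` — by `IsStronglyExpAlgClosed.isLinIndepExpAlgClosed`). Def. 5.14: *whenever
`F_base ◁ A ◁ F` with `A` finitely generated over `F_base` and `A ◁ B` is a finitely generated
Γ-algebraic extension, then `B` embeds (necessarily strongly) into `F` over `A`.*
Instance stated, in the vocabulary of `GammaFields.lean`/`ZilberSaturation.lean` (exactly as in
`Literature.NumberTheory.Transcendental.BaysKirby2018_saturation_of_isExpAlgClosed`, whose base is instead a countable Γ-closed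
`K`): `A = ℚτ + ℚc' ◁ F`; `B = ⟨ℚτ, c, e⟩ ⊆ F` regarded as an extension of `A` through the
Γ-isomorphism `⟨ℚτ, c⟩ ≅ ⟨ℚτ, c'⟩`, `c ↦ c'`, over `ℚτ` (`GammaField.IsGammaIso`, i.e. over the
field `ℚ^{ab}(τ) = ℚ(ℚτ, exp ℚτ)`), where `ℚτ + ℚc ◁ F`, `δ(e/ℚτ + ℚc) = 0` (Γ-algebraic,
Def. 5.11) and — a harmless extra hypothesis — `ℚτ + ℚc + ℚe ◁ F`. Conclusion: a tuple `e'`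
with `(c, e) ↦ (c', e')` a Γ-isomorphism over `ℚτ` and `ℚτ + ℚc' + ℚe' ◁ F`.
The printed proof: good bases (Prop. 3.19, Kummer genericity), freeness and rotundity of their
loci (Cor. 7.4), axiom 4, and `δ ≥ 0` over `A`. Users take `(h : …)`; it is the one deep input
of `Literature.NumberTheory.Transcendental.IsZilberField.isQuasiminimal_of_saturation` below.
[cite: BaysKirby2018ANT, Lemma 8.3 with Def. 5.14 (setting of Thm 9.1)] -/
def BaysKirby2018_saturation_of_isStronglyExpAlgClosed : Prop :=
  ∀ {F : Type*} [Field F] [CharZero F] [Literature.ModelTheory.ExponentialFields.ExponentialRing F],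
    IsAlgClosed F → Literature.ModelTheory.ExponentialFields.ExponentialRing.IsSurjectiveOntoUnits F →
    ∀ {τ : F}, Transcendental ℚ τ → expKernel F = AddSubgroup.zmultiples τ →
    Literature.ModelTheory.ExponentialFields.SchanuelProperty F → IsStronglyExpAlgClosed F →
    ∀ {N k : ℕ} {c c' : Fin N → F} {e : Fin k → F},
      IsStrong (Submodule.span ℚ {τ} ⊔ Submodule.span ℚ (range c)) →
      IsStrong (Submodule.span ℚ {τ} ⊔ Submodule.span ℚ (range c')) →
      IsGammaIso (Submodule.span ℚ {τ}) c c' →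
      predim (Submodule.span ℚ {τ} ⊔ Submodule.span ℚ (range c)) (Submodule.span ℚ (range e)) = 0 →
      IsStrong (Submodule.span ℚ {τ} ⊔ Submodule.span ℚ (range (Fin.append c e))) →
      ∃ e' : Fin k → F, IsGammaIso (Submodule.span ℚ {τ}) (Fin.append c e) (Fin.append c' e') ∧
        IsStrong (Submodule.span ℚ {τ} ⊔ Submodule.span ℚ (range (Fin.append c' e')))

/-- NAMED FACT (a theorem in universe `0`, `Kirby2010_isGammaClosed_ecl_holds₀`) — **`ecl`-closed
sets are Γ-closed** (Kirby 2010, *Exponential algebraicity in exponential fields*, Thm 1.2: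
`td(x̄, exp x̄/C) - ldim_ℚ(x̄/C) ≥ dim(x̄/C)` for `C` `ecl`-closed; Bays–Kirby 2018, Remark 10.10 and
Lemma 4.10: for `H = ecl H` every proper finitely generated extension `H + ℚx̄` has
`δ(x̄/H) ≥ 1`). In any exponential field of characteristic zero and for every `C`, the subspace
`ecl C` is Γ-closed (`GammaField.IsGammaClosed`). The tree proves this for fields in `Type`
(`Literature.NumberTheory.Transcendental.GammaField.isGammaClosed_span_ecl`, from Ax's theorem `Literature.NumberTheory.Transcendental.ax_schanuel`,
which is stated for fields in `Type`); the universe-polymorphic statement is recorded here as a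
named fact; its countable case under the countable closure property — all that is used below — is
the theorem `Literature.NumberTheory.Transcendental.GammaField.isGammaClosed_span_ecl_of_countable` (`GammaFieldsEclTransfer.lean`).
[cite: Kirby2010, Thm. 1.2] [cite: BaysKirby2018ANT, Remark 10.10] -/
def Kirby2010_isGammaClosed_ecl : Prop :=
  ∀ {F : Type*} [Field F] [CharZero F] [Literature.ModelTheory.ExponentialFields.ExponentialRing F] (C : Set F),
    IsGammaClosed (Submodule.span ℚ (ecl C))

/-- `Kirby2010_isGammaClosed_ecl` **holds for fields in `Type`**: `isGammaClosed_span_ecl` with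
Ax's theorem `ax_schanuel_holds`. [cite: Kirby2010, Thm. 1.2] -/
theorem Kirby2010_isGammaClosed_ecl_holds₀ : Kirby2010_isGammaClosed_ecl.{0} :=
  fun C => isGammaClosed_span_ecl Transcendental.ax_schanuel_holds C

namespace ZilberHomogeneity

/-! ### Tuples: ranges and re-indexing -/

section Tuples

variable {α : Type*}

/-- `range (x ++ u) = range x ∪ range u`. [folklore] -/
theorem range_append {n k : ℕ} (x : Fin n → α) (u : Fin k → α) :
    range (Fin.append x u) = range x ∪ range u := by
  ext a
  constructor
  · rintro ⟨i, rfl⟩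
    induction i using Fin.addCases with
    | left j => exact Or.inl ⟨j, by simp⟩
    | right j => exact Or.inr ⟨j, by simp⟩
  · rintro (⟨j, rfl⟩ | ⟨j, rfl⟩)
    · exact ⟨Fin.castAdd k j, by simp⟩
    · exact ⟨Fin.natAdd n j, by simp⟩

/-- `range ![a] = {a}` (Mathlib's `Matrix.range_cons_empty`). [folklore] -/
theorem range_single (a : α) : range ![a] = {a} :=
  Matrix.range_cons_empty a _

/-- The re-indexing presenting `((x, zᵢ₀), (u, z))` as a sub-tuple of `((x, u), z)`. [folklore] -/
def snocIdx (n k m : ℕ) (i₀ : Fin m) : Fin (n + 1 + (k + m)) → Fin (n + k + m) :=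
  Fin.append (Fin.snoc (fun i : Fin n => Fin.castAdd m (Fin.castAdd k i)) (Fin.natAdd (n + k) i₀))
    (Fin.append (fun j : Fin k => Fin.castAdd m (Fin.natAdd n j)) fun l : Fin m => Fin.natAdd (n + k) l)

/-- `((x, zᵢ₀), (u, z)) = ((x, u), z) ∘ snocIdx`. [folklore] -/
theorem append_snoc_eq_comp_snocIdx {n k m : ℕ} (x : Fin n → α) (u : Fin k → α) (z : Fin m → α)
    (i₀ : Fin m) :
    Fin.append (Fin.snoc x (z i₀) : Fin (n + 1) → α) (Fin.append u z) =
      Fin.append (Fin.append x u) z ∘ snocIdx n k m i₀ := by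
  funext t
  induction t using Fin.addCases with
  | left i =>
    refine Fin.lastCases ?_ (fun j => ?_) i
    · simp [snocIdx]
    · simp [snocIdx]
  | right j =>
    induction j using Fin.addCases with
    | left j => simp [snocIdx]
    | right l => simp [snocIdx]

/-- The range of `((x, zᵢ₀), (u, z))` is that of `((x, u), z)`. [folklore] -/
theorem range_append_snoc {n k m : ℕ} (x : Fin n → α) (u : Fin k → α) (z : Fin m → α)
    (i₀ : Fin m) :
    range (Fin.append (Fin.snoc x (z i₀) : Fin (n + 1) → α) (Fin.append u z)) =
      range (Fin.append (Fin.append x u) z) := by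
  rw [range_append, range_append, range_append, range_append, Fin.range_snoc]
  ext a
  simp only [mem_union, mem_insert_iff, mem_range]
  constructor
  · rintro ((rfl | h) | h | h)
    · exact Or.inr ⟨i₀, rfl⟩
    · exact Or.inl (Or.inl h)
    · exact Or.inl (Or.inr h)
    · exact Or.inr h
  · rintro ((h | h) | h)
    · exact Or.inl (Or.inr h)
    · exact Or.inr (Or.inl h)
    · exact Or.inr (Or.inr h)

end Tuples

/-! ### Re-indexing Γ-isomorphisms -/

section Reindex

variable {F : Type*} [Field F] [CharZero F] [Literature.ModelTheory.ExponentialFields.ExponentialRing F] {K : Submodule ℚ F}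

omit [CharZero F] in
/-- Level generators of a re-indexed tuple. [folklore] -/
theorem lvGens_comp {N m : ℕ} (M : ℕ) (c : Fin N → F) (σ : Fin m → Fin N) :
    lvGens M (c ∘ σ) = lvGens M c ∘ Sum.map σ σ := by
  funext s; rcases s with i | i <;> rfl

/-- **Γ-isomorphisms restrict to sub-tuples and are stable under re-indexing.** [folklore] -/
theorem _root_.Literature.NumberTheory.Transcendental.GammaField.IsGammaIso.comp {N m : ℕ} {c c' : Fin N → F}
    (h : IsGammaIso K c c') (σ : Fin m → Fin N) : IsGammaIso K (c ∘ σ) (c' ∘ σ) := by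
  rw [isGammaIso_iff_ker_eq] at h ⊢
  intro M
  rw [lvGens_comp, lvGens_comp]
  exact ker_aeval_comp_eq (h M) _

end Reindex

/-! ### The back-and-forth system of a Zilber field: Γ-isomorphic strong hulls over `ℚτ` -/

section System

variable {F : Type u} [Field F] [CharZero F] [Literature.ModelTheory.ExponentialFields.ExponentialRing F]

/-- **The system of local isomorphisms of a Zilber field.** For `τ` a generator of `ker exp`,
the `n`-tuples `x` and `y` *correspond* if they extend to finite tuples `(x, u)`, `(y, v)`
spanning, together with `τ`, *strong* subspaces `ℚτ + ℚx + ℚu ◁ F`, `ℚτ + ℚy + ℚv ◁ F`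
(`GammaField.IsStrong`) which are Γ-isomorphic over `ℚτ` via `(x, u) ↦ (y, v)`
(`GammaField.IsGammaIso`: an isomorphism of the exponential fields generated, over `ℚ^{ab}(τ)`,
matching all division points `exp (w/m)`). These are the partial isomorphisms between finitely
generated strong partial E-subfields of the `ℵ₀`-homogeneity arguments of Zilber 2005 §5 and
Bays–Kirby 2013 §3 (proof of Prop. 5, "`ℵ₀`-homogeneity over `∅`"), cf. Bays–Kirby 2013,
Lemma 3 (isomorphic strong partial E-subfields have the same quantifier-free type).
[cite: BaysKirby2013Excellence, Lemma 3 and Prop. 5 (proof)] -/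
def HullIsoRel (τ : F) (n : ℕ) (x y : Fin n → F) : Prop :=
  ∃ (k : ℕ) (u v : Fin k → F),
    IsStrong (Submodule.span ℚ {τ} ⊔ Submodule.span ℚ (range (Fin.append x u))) ∧
    IsStrong (Submodule.span ℚ {τ} ⊔ Submodule.span ℚ (range (Fin.append y v))) ∧
    IsGammaIso (Submodule.span ℚ {τ}) (Fin.append x u) (Fin.append y v)

namespace HullIsoRel

variable {τ : F}

/-- Symmetry. [folklore] -/
protected theorem symm {n : ℕ} {x y : Fin n → F} (h : HullIsoRel τ n x y) : HullIsoRel τ n y x := by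
  obtain ⟨k, u, v, hu, hv, hiso⟩ := h
  exact ⟨k, v, u, hv, hu, hiso.symm⟩

/-- Sub-tuples and re-indexings correspond (keep the whole tuple among the extra witnesses).
[folklore] -/
theorem comp {n : ℕ} {x y : Fin n → F} (h : HullIsoRel τ n x y) {m : ℕ} (g : Fin m → Fin n) :
    HullIsoRel τ m (x ∘ g) (y ∘ g) := by
  obtain ⟨k, u, v, hu, hv, hiso⟩ := h
  let σ : Fin (m + (n + k)) → Fin (n + k) := Fin.append (fun i => Fin.castAdd k (g i)) fun j => j
  have hσ : ∀ w : Fin n → F, ∀ t : Fin k → F,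
      Fin.append (w ∘ g) (Fin.append w t) = Fin.append w t ∘ σ := by
    intro w t
    funext s
    induction s using Fin.addCases with
    | left i => simp [σ]
    | right j => simp [σ]
  have hr : ∀ w : Fin n → F, ∀ t : Fin k → F,
      range (Fin.append (w ∘ g) (Fin.append w t)) = range (Fin.append w t) := by
    intro w t
    rw [range_append, union_eq_right]
    rw [range_append]
    exact (range_comp_subset_range g w).trans subset_union_left
  refine ⟨n + k, Fin.append x u, Fin.append y v, ?_, ?_, ?_⟩
  · rwa [hr]
  · rwa [hr]
  · rw [hσ, hσ]
    exact hiso.comp σ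

/-- Corresponding tuples satisfy the same polynomial identities among their coordinates and
exponentials (level `0` of the Γ-isomorphism). [folklore] -/
theorem aeval_eq_zero_iff {n : ℕ} {x y : Fin n → F} (h : HullIsoRel τ n x y)
    (P : MvPolynomial (Fin n ⊕ Fin n) (fieldOf (Submodule.span ℚ {τ}))) :
    MvPolynomial.aeval (Sum.elim x (exp ∘ x)) P = 0 ↔
      MvPolynomial.aeval (Sum.elim y (exp ∘ y)) P = 0 := by
  obtain ⟨k, u, v, -, -, hiso⟩ := h
  have h0 := (hiso.comp (Fin.castAdd k)).aeval_eq_zero_iff 0 P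
  have e1 : ∀ (w : Fin n → F) (t : Fin k → F),
      lvGens 0 (Fin.append w t ∘ Fin.castAdd k) = Sum.elim w (exp ∘ w) := by
    intro w t
    funext s
    rcases s with i | i <;> simp [lvGens]
  rwa [e1, e1] at h0

/-- Corresponding tuples have the same equalities between coordinates. [folklore] -/
theorem apply_eq {n : ℕ} {x y : Fin n → F} (h : HullIsoRel τ n x y) {i j : Fin n}
    (hij : x i = x j) : y i = y j := by
  have := h.aeval_eq_zero_iff (MvPolynomial.X (Sum.inl i) - MvPolynomial.X (Sum.inl j))
  simp only [map_sub, MvPolynomial.aeval_X, Sum.elim_inl, sub_eq_zero] at this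
  exact this.1 hij

/-- Corresponding tuples satisfy the same unnested equations `xᵢ = xⱼ + xₗ`, `xᵢ = xⱼ xₗ`,
`xᵢ = -xⱼ`, `xᵢ = 0`, `xᵢ = 1`, `xᵢ = exp xⱼ`. [folklore] -/
theorem funMap_eq {n : ℕ} {x y : Fin n → F} (h : HullIsoRel τ n x y) {k : ℕ}
    (f : Literature.ModelTheory.ExponentialFields.Language.expRing.Functions k) (ι : Fin k → Fin n) (i : Fin n)
    (hi : x i = FirstOrder.Language.Structure.funMap f (x ∘ ι)) :
    y i = FirstOrder.Language.Structure.funMap f (y ∘ ι) := by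
  cases f with
  | add =>
    have := h.aeval_eq_zero_iff (MvPolynomial.X (Sum.inl i) -
      (MvPolynomial.X (Sum.inl (ι 0)) + MvPolynomial.X (Sum.inl (ι 1))))
    rw [Literature.ModelTheory.ExponentialFields.Language.expRing.funMap_add] at hi ⊢
    simp only [map_sub, map_add, MvPolynomial.aeval_X, Sum.elim_inl, sub_eq_zero,
      Function.comp_apply] at this hi ⊢
    exact this.1 hi
  | mul =>
    have := h.aeval_eq_zero_iff (MvPolynomial.X (Sum.inl i) -
      MvPolynomial.X (Sum.inl (ι 0)) * MvPolynomial.X (Sum.inl (ι 1)))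
    rw [Literature.ModelTheory.ExponentialFields.Language.expRing.funMap_mul] at hi ⊢
    simp only [map_sub, map_mul, MvPolynomial.aeval_X, Sum.elim_inl, sub_eq_zero,
      Function.comp_apply] at this hi ⊢
    exact this.1 hi
  | neg =>
    have := h.aeval_eq_zero_iff (MvPolynomial.X (Sum.inl i) + MvPolynomial.X (Sum.inl (ι 0)))
    rw [Literature.ModelTheory.ExponentialFields.Language.expRing.funMap_neg] at hi ⊢
    simp only [map_add, MvPolynomial.aeval_X, Sum.elim_inl, Function.comp_apply] at this hi ⊢
    rw [eq_neg_iff_add_eq_zero] at hi ⊢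
    exact this.1 hi
  | zero =>
    have := h.aeval_eq_zero_iff (MvPolynomial.X (Sum.inl i))
    rw [Literature.ModelTheory.ExponentialFields.Language.expRing.funMap_zero] at hi ⊢
    simp only [MvPolynomial.aeval_X, Sum.elim_inl] at this
    exact this.1 hi
  | one =>
    have := h.aeval_eq_zero_iff (MvPolynomial.X (Sum.inl i) - 1)
    rw [Literature.ModelTheory.ExponentialFields.Language.expRing.funMap_one] at hi ⊢
    simp only [map_sub, map_one, MvPolynomial.aeval_X, Sum.elim_inl, sub_eq_zero] at this
    exact this.1 hi
  | exp =>
    have := h.aeval_eq_zero_iff (MvPolynomial.X (Sum.inl i) - MvPolynomial.X (Sum.inr (ι 0)))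
    rw [Literature.ModelTheory.ExponentialFields.Language.expRing.funMap_exp] at hi ⊢
    simp only [map_sub, MvPolynomial.aeval_X, Sum.elim_inl, Sum.elim_inr, sub_eq_zero,
      Function.comp_apply] at this hi ⊢
    exact this.1 hi

/-- The language of exponential rings has no relation symbols. [folklore] -/
theorem relMap {n : ℕ} {x y : Fin n → F} (_h : HullIsoRel τ n x y) {k : ℕ}
    (R : Literature.ModelTheory.ExponentialFields.Language.expRing.Relations k) (ι : Fin k → Fin n)
    (_hR : FirstOrder.Language.Structure.RelMap R (x ∘ ι)) :
    FirstOrder.Language.Structure.RelMap R (y ∘ ι) := by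
  cases R

/-- **One-point extensions from extensions of the witnesses**: if `((x, u), z) ↦ ((y, v), e')`
is a Γ-isomorphism over `ℚτ` between tuples spanning (with `τ`) strong subspaces, then
`(x, zᵢ₀)` and `(y, e'ᵢ₀)` correspond. [folklore] -/
theorem snoc_of_append {n k m : ℕ} {x y : Fin n → F} {u v : Fin k → F} {z e' : Fin m → F}
    (hX : IsStrong (Submodule.span ℚ {τ} ⊔ Submodule.span ℚ (range (Fin.append (Fin.append x u) z))))
    (hY : IsStrong (Submodule.span ℚ {τ} ⊔ Submodule.span ℚ (range (Fin.append (Fin.append y v) e'))))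
    (hiso : IsGammaIso (Submodule.span ℚ {τ}) (Fin.append (Fin.append x u) z)
      (Fin.append (Fin.append y v) e')) (i₀ : Fin m) :
    HullIsoRel τ (n + 1) (Fin.snoc x (z i₀)) (Fin.snoc y (e' i₀)) := by
  refine ⟨k + m, Fin.append u z, Fin.append v e', ?_, ?_, ?_⟩
  · rwa [range_append_snoc]
  · rwa [range_append_snoc]
  · rw [append_snoc_eq_comp_snocIdx, append_snoc_eq_comp_snocIdx]
    exact hiso.comp _

omit [Literature.ModelTheory.ExponentialFields.ExponentialRing F] in
/-- The subspace spanned with `τ` by `((x, u), a)` is `(ℚτ + ℚx + ℚu) + ℚa`. [folklore] -/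
theorem span_append_single {N : ℕ} (c : Fin N → F) (a : F) :
    Submodule.span ℚ {τ} ⊔ Submodule.span ℚ (range (Fin.append c ![a])) =
      (Submodule.span ℚ {τ} ⊔ Submodule.span ℚ (range c)) ⊔ Submodule.span ℚ {a} := by
  rw [range_append, range_single, Submodule.span_union, sup_assoc]

/-- One-point extensions by single generic elements: the case `m = 1` of `snoc_of_append`.
[folklore] -/
theorem snoc_of_append_single {n k : ℕ} {x y : Fin n → F} {u v : Fin k → F} {a b : F}
    (hX : IsStrong ((Submodule.span ℚ {τ} ⊔ Submodule.span ℚ (range (Fin.append x u))) ⊔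
      Submodule.span ℚ {a}))
    (hY : IsStrong ((Submodule.span ℚ {τ} ⊔ Submodule.span ℚ (range (Fin.append y v))) ⊔
      Submodule.span ℚ {b}))
    (hiso : IsGammaIso (Submodule.span ℚ {τ}) (Fin.append (Fin.append x u) ![a])
      (Fin.append (Fin.append y v) ![b])) :
    HullIsoRel τ (n + 1) (Fin.snoc x a) (Fin.snoc y b) := by
  have := snoc_of_append (τ := τ) (by rwa [span_append_single]) (by rwa [span_append_single]) hiso 0
  simpa using this

end HullIsoRel

/-! ### Genericity bookkeeping -/

section Generic

variable {τ : F}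

omit [CharZero F] in
/-- `τ ∈ ecl C` when `ker exp = τℤ`. [cite: Kirby2010, Lemma 3.3] -/
theorem tau_mem_ecl (hker : expKernel F = AddSubgroup.zmultiples τ) (C : Set F) : τ ∈ ecl C := by
  refine expKernel_subset_ecl C ?_
  rw [hker]
  exact AddSubgroup.mem_zmultiples τ

/-- `ℚτ + ℚc ≤ ecl c`. [folklore] -/
theorem base_sup_span_le_span_ecl (hker : expKernel F = AddSubgroup.zmultiples τ) {N : ℕ}
    (c : Fin N → F) :
    Submodule.span ℚ {τ} ⊔ Submodule.span ℚ (range c) ≤ Submodule.span ℚ (ecl (range c)) := by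
  refine sup_le (Submodule.span_le.2 ?_) (span_le_span_ecl _)
  rintro _ rfl
  exact (mem_span_ecl_iff).2 (tau_mem_ecl hker _)

/-- In an uncountable field with the countable closure property there are elements outside
`ecl` of any finite tuple. [cite: BHHKK2014, Lemma 2.2 (proof)] -/
theorem exists_not_mem_span_ecl [Uncountable F] (hccp : HasCountableClosureProperty F) {N : ℕ}
    (c : Fin N → F) : ∃ b : F, b ∉ Submodule.span ℚ (ecl (range c)) := by
  by_contra! hcon
  have hc : ((Submodule.span ℚ (ecl (range c)) : Submodule ℚ F) : Set F).Countable :=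
    countable_span_ecl hccp (countable_range c)
  exact not_countable_univ (hc.mono fun z _ => hcon z)

/-- **Generic one-point extensions of strong subspaces** (Bays–Kirby 2018, Lemma 4.13, with the
Γ-closed subspace `ecl c`): if `ℚτ + ℚc ◁ F` and `b ∉ ecl c` then `ℚτ + ℚc + ℚb ◁ F` and
`td(b, exp b/ℚτ + ℚc) = 2`. [cite: BaysKirby2018ANT, Lemma 4.13] -/
theorem isStrong_sup_and_td_eq_two
    (hΓ : ∀ {N : ℕ} (c : Fin N → F), IsGammaClosed (Submodule.span ℚ (ecl (range c))))
    (hker : expKernel F = AddSubgroup.zmultiples τ) {N : ℕ} {c : Fin N → F}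
    (hX : IsStrong (Submodule.span ℚ {τ} ⊔ Submodule.span ℚ (range c))) {b : F}
    (hb : b ∉ Submodule.span ℚ (ecl (range c))) :
    IsStrong ((Submodule.span ℚ {τ} ⊔ Submodule.span ℚ (range c)) ⊔ Submodule.span ℚ {b}) ∧
      td (Submodule.span ℚ {τ} ⊔ Submodule.span ℚ (range c)) (Submodule.span ℚ {b}) = 2 := by
  have hle := base_sup_span_le_span_ecl hker c
  obtain ⟨hs, hδ⟩ := hX.sup_span_singleton (hΓ _) hle hb
  exact ⟨hs, td_span_singleton_eq_two (fun h => hb (hle h)) hδ⟩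

/-- `a` is **Γ-algebraic** over `X`: it belongs to a finite tuple of predimension `0` over `X`
(Bays–Kirby 2018, Def. 5.11; Zilber 2005 §2, `ecl`). [cite: BaysKirby2018ANT, Def. 5.11] -/
def IsGammaAlgebraic (X : Submodule ℚ F) (a : F) : Prop :=
  ∃ (m : ℕ) (z : Fin m → F), (∃ i, z i = a) ∧ predim X (Submodule.span ℚ (range z)) = 0

/-- **Non-Γ-algebraic elements are generic**: over a strong `X`, if `a` is not Γ-algebraic then
`a ∉ X`, `δ(a/X) = 1`, `td(a, exp a/X) = 2` and `X + ℚa ◁ F`. [cite: BaysKirby2018ANT, Lemma 4.13 (proof)] -/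
theorem isStrong_sup_of_not_isGammaAlgebraic {X : Submodule ℚ F} (hX : IsStrong X) {a : F}
    (ha : ¬ IsGammaAlgebraic X a) :
    IsStrong (X ⊔ Submodule.span ℚ {a}) ∧ td X (Submodule.span ℚ {a}) = 2 := by
  classical
  have haX : a ∉ X := fun h => ha ⟨1, ![a], ⟨0, rfl⟩, predim_eq_zero_of_le (by
    rw [range_single, Submodule.span_le, singleton_subset_iff]; exact h)⟩
  have hfg1 : IsFG X (Submodule.span ℚ ({a} : Set F)) := isFG_span_of_finite X (finite_singleton a)
  -- every finitely generated `Z ⊇ X + ℚa` has `δ(Z/X) ≥ 1`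
  have key : ∀ Z : Submodule ℚ F, X ⊔ Submodule.span ℚ {a} ≤ Z → IsFG X Z → 1 ≤ predim X Z := by
    intro Z hZ hfg
    have h0 : 0 ≤ predim X Z := hX (le_sup_left.trans hZ) hfg
    by_contra hlt
    have hzero : predim X Z = 0 := by omega
    obtain ⟨s, hsZ, hZs⟩ := isFG_iff_exists_finset.1 hfg
    have haZ : a ∈ Z := hZ (Submodule.mem_sup_right (Submodule.mem_span_singleton_self a))
    set t : Finset F := insert a s with ht
    have htZ : X ⊔ Submodule.span ℚ (t : Set F) = Z := by
      refine le_antisymm (sup_le (le_sup_left.trans hZ) (Submodule.span_le.2 ?_)) ?_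
      · intro w hw
        rcases Finset.mem_insert.1 hw with rfl | hw
        · exact haZ
        · exact hsZ hw
      · refine hZs.trans (sup_le le_sup_left ?_)
        exact (Submodule.span_mono (Finset.coe_subset.2 (Finset.subset_insert a s))).trans le_sup_right
    let z : Fin t.card → F := fun i => (t.equivFin.symm i : F)
    have hzr : range z = (t : Set F) := by
      ext w
      constructor
      · rintro ⟨i, rfl⟩; exact (t.equivFin.symm i).2
      · intro hw; exact ⟨t.equivFin ⟨w, hw⟩, by simp [z]⟩
    refine ha ⟨t.card, z, ⟨t.equivFin ⟨a, Finset.mem_insert_self a s⟩, by simp [z]⟩, ?_⟩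
    rw [hzr, ← predim_sup_left, htZ, hzero]
  have hδ : predim X (Submodule.span ℚ {a}) = 1 := by
    have hup := predim_span_singleton_le haX
    have hlow : 1 ≤ predim X (Submodule.span ℚ {a}) := by
      rw [← predim_sup_left]
      exact key _ le_rfl (isFG_sup_left.2 hfg1)
    omega
  refine ⟨?_, td_span_singleton_eq_two haX hδ⟩
  intro Z hZ hfgZ
  have hfgXZ : IsFG X Z := (isFG_sup_left.2 hfg1).trans hfgZ
  have hadd := predim_add (le_sup_left : X ≤ X ⊔ Submodule.span ℚ {a}) hZ hfgXZ
  rw [predim_sup_left, hδ] at hadd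
  linarith [key Z hZ hfgXZ]

end Generic

/-! ### Forth -/

section Forth

variable {τ : F}

/-- **Forth over a Γ-algebraic element: saturation.** [cite: BaysKirby2018ANT, Lemma 8.3] -/
theorem forth_of_isGammaAlgebraic (hSat : BaysKirby2018_saturation_of_isStronglyExpAlgClosed.{u})
    (hK : IsZilberField F) (hτ : Transcendental ℚ τ) (hker : expKernel F = AddSubgroup.zmultiples τ)
    {n k : ℕ} {x y : Fin n → F} {u v : Fin k → F}
    (hX : IsStrong (Submodule.span ℚ {τ} ⊔ Submodule.span ℚ (range (Fin.append x u))))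
    (hY : IsStrong (Submodule.span ℚ {τ} ⊔ Submodule.span ℚ (range (Fin.append y v))))
    (hiso : IsGammaIso (Submodule.span ℚ {τ}) (Fin.append x u) (Fin.append y v)) {a : F}
    (ha : IsGammaAlgebraic (Submodule.span ℚ {τ} ⊔ Submodule.span ℚ (range (Fin.append x u))) a) :
    ∃ b : F, HullIsoRel τ (n + 1) (Fin.snoc x a) (Fin.snoc y b) := by
  obtain ⟨m, z, ⟨i₀, rfl⟩, hδ⟩ := ha
  set X := Submodule.span ℚ {τ} ⊔ Submodule.span ℚ (range (Fin.append x u)) with hXdef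
  have hsplit : ∀ (c : Fin (n + k) → F) (w : Fin m → F),
      Submodule.span ℚ {τ} ⊔ Submodule.span ℚ (range (Fin.append c w)) =
        (Submodule.span ℚ {τ} ⊔ Submodule.span ℚ (range c)) ⊔ Submodule.span ℚ (range w) := by
    intro c w
    rw [range_append, Submodule.span_union, sup_assoc]
  have hXz : IsStrong (Submodule.span ℚ {τ} ⊔ Submodule.span ℚ (range (Fin.append (Fin.append x u) z))) := by
    rw [hsplit]
    refine hX.of_predim_eq_zero le_sup_left (isFG_sup_left.2
      (isFG_span_of_finite X (finite_range z))) ?_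
    rwa [predim_sup_left]
  obtain ⟨e', hiso', hY'⟩ := hSat hK.isAlgClosed hK.isSurjectiveOntoUnits hτ hker
    hK.schanuelProperty hK.isStronglyExpAlgClosed hX hY hiso hδ hXz
  exact ⟨e' i₀, HullIsoRel.snoc_of_append hXz hY' hiso' i₀⟩

/-- **Forth over a generic element: uniqueness of the generic type.** [cite: BaysKirby2013Excellence, Prop. 5 (i)] -/
theorem forth_of_not_isGammaAlgebraic [Uncountable F]
    (hΓ : ∀ {N : ℕ} (c : Fin N → F), IsGammaClosed (Submodule.span ℚ (ecl (range c))))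
    (hccp : HasCountableClosureProperty F) (hker : expKernel F = AddSubgroup.zmultiples τ)
    {n k : ℕ} {x y : Fin n → F} {u v : Fin k → F}
    (hX : IsStrong (Submodule.span ℚ {τ} ⊔ Submodule.span ℚ (range (Fin.append x u))))
    (hY : IsStrong (Submodule.span ℚ {τ} ⊔ Submodule.span ℚ (range (Fin.append y v))))
    (hiso : IsGammaIso (Submodule.span ℚ {τ}) (Fin.append x u) (Fin.append y v)) {a : F}
    (ha : ¬ IsGammaAlgebraic (Submodule.span ℚ {τ} ⊔ Submodule.span ℚ (range (Fin.append x u))) a) :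
    ∃ b : F, HullIsoRel τ (n + 1) (Fin.snoc x a) (Fin.snoc y b) := by
  obtain ⟨hXa, htd⟩ := isStrong_sup_of_not_isGammaAlgebraic hX ha
  obtain ⟨b, hb⟩ := exists_not_mem_span_ecl hccp (Fin.append y v)
  obtain ⟨hYb, htd'⟩ := isStrong_sup_and_td_eq_two hΓ hker hY hb
  exact ⟨b, HullIsoRel.snoc_of_append_single hXa hYb (hiso.append_singleton htd htd')⟩

/-- **The Γ-isomorphisms between strong hulls of an uncountable Zilber field form a
back-and-forth system of local isomorphisms** (`FirstOrder.Language.IsLocalIsoSystem`), granted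
`ℵ₀`-saturation for exponentially-algebraic extensions
(`BaysKirby2018_saturation_of_isStronglyExpAlgClosed`) and Γ-closedness of `ecl`-closed sets:
restriction, preservation of unnested atomic facts, and forth — over a Γ-algebraic element by
saturation, over any other element by a generic element on the other side (countable closure
property and uncountability) and the uniqueness of the generic type. This is the
"`ℵ₀`-homogeneity over `∅`" of Bays–Kirby 2013, proof of Prop. 5, for finite tuples of `F`.
[cite: BaysKirby2013Excellence, Prop. 5 (proof)] [cite: BaysKirby2018ANT, Lemma 8.3] -/
theorem isLocalIsoSystem_hullIsoRel [Uncountable F]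
    (hSat : BaysKirby2018_saturation_of_isStronglyExpAlgClosed.{u})
    (hΓ : ∀ {N : ℕ} (c : Fin N → F), IsGammaClosed (Submodule.span ℚ (ecl (range c))))
    (hK : IsZilberField F) (hτ : Transcendental ℚ τ) (hker : expKernel F = AddSubgroup.zmultiples τ) :
    Literature.ModelTheory.ExponentialFields.Language.expRing.IsLocalIsoSystem (HullIsoRel τ) where
  symm hxy := hxy.symm
  comp hxy _ g := hxy.comp g
  apply_eq hxy _ _ hij := hxy.apply_eq hij
  funMap_eq hxy _ f ι i hi := hxy.funMap_eq f ι i hi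
  relMap hxy _ R ι hR := hxy.relMap R ι hR
  forth := by
    rintro n x y ⟨k, u, v, hX, hY, hiso⟩ a
    by_cases ha : IsGammaAlgebraic (Submodule.span ℚ {τ} ⊔ Submodule.span ℚ (range (Fin.append x u))) a
    · exact forth_of_isGammaAlgebraic hSat hK hτ hker hX hY hiso ha
    · exact forth_of_not_isGammaAlgebraic hΓ hK.hasCountableClosureProperty hker hX hY hiso ha

end Forth

/-! ### Uniqueness of the generic type over a finite tuple -/

section Hgen

variable {τ : F}

/-- **Hulls of finite tuples**: granted the Schanuel property, every finite tuple `b` extends to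
a tuple `(b, u)` with `ℚτ + ℚb + ℚu ◁ F` (Bays–Kirby 2018, Def. 4.6, the hull `⌈τ, b⌉`, over the
strong zero subspace). [cite: BaysKirby2018ANT, Def. 4.6] -/
theorem exists_isStrong_append (hSP : Literature.ModelTheory.ExponentialFields.SchanuelProperty F) (τ : F) {n : ℕ} (b : Fin n → F) :
    ∃ (k : ℕ) (u : Fin k → F),
      IsStrong (Submodule.span ℚ {τ} ⊔ Submodule.span ℚ (range (Fin.append b u))) := by
  classical
  have h0 := isStrong_bot_of_schanuelProperty hSP
  set Λ' : Submodule ℚ F := Submodule.span ℚ (insert τ (range b)) with hΛ'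
  have hfg : IsFG (⊥ : Submodule ℚ F) Λ' :=
    isFG_span_of_finite ⊥ ((finite_range b).insert τ)
  obtain ⟨D, hD, hfgD, hsD⟩ := h0.exists_isStrong bot_le hfg
  obtain ⟨s, hsD', hDs⟩ := isFG_iff_exists_finset.1 hfgD
  rw [bot_sup_eq] at hDs
  have hDeq : D = Submodule.span ℚ (s : Set F) := le_antisymm hDs (Submodule.span_le.2 hsD')
  let u : Fin s.card → F := fun i => (s.equivFin.symm i : F)
  have hur : range u = (s : Set F) := by
    ext w
    constructor
    · rintro ⟨i, rfl⟩; exact (s.equivFin.symm i).2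
    · intro hw; exact ⟨s.equivFin ⟨w, hw⟩, by simp [u]⟩
  refine ⟨s.card, u, ?_⟩
  have heq : Submodule.span ℚ {τ} ⊔ Submodule.span ℚ (range (Fin.append b u)) = D := by
    refine le_antisymm ?_ ?_
    · rw [range_append, hur, Submodule.span_union, ← sup_assoc]
      refine sup_le (sup_le ?_ ?_) (hDeq ▸ le_rfl)
      · exact (Submodule.span_mono (singleton_subset_iff.2 (mem_insert τ _))).trans hD
      · exact (Submodule.span_mono (subset_insert τ _)).trans hD
    · rw [hDeq, range_append, hur, Submodule.span_union]
      exact le_sup_right.trans le_sup_right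
  rwa [heq]

/-- **Uniqueness of the generic type over a finite tuple** (Kirby 2010, quasiminimal excellent
classes, Lemma 5.1, first part; Bays–Kirby 2013, Prop. 5 (i)): for every finite tuple `b` there is
a countable set — `ecl` of a hull of `(τ, b)` — outside of which any two elements correspond over
`b`. [cite: Kirby2010QMEC, Lemma 5.1] [cite: BaysKirby2013Excellence, Prop. 5 (i)] -/
theorem exists_countable_generic
    (hΓ : ∀ {N : ℕ} (c : Fin N → F), IsGammaClosed (Submodule.span ℚ (ecl (range c))))
    (hK : IsZilberField F) (hker : expKernel F = AddSubgroup.zmultiples τ) {n : ℕ}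
    (b : Fin n → F) :
    ∃ H : Set F, H.Countable ∧ ∀ ⦃a c : F⦄, a ∉ H → c ∉ H →
      HullIsoRel τ (n + 1) (Fin.snoc b a) (Fin.snoc b c) := by
  obtain ⟨k, u, hX⟩ := exists_isStrong_append hK.schanuelProperty τ b
  refine ⟨(Submodule.span ℚ (ecl (range (Fin.append b u))) : Set F),
    countable_span_ecl hK.hasCountableClosureProperty (countable_range _), fun a c ha hc => ?_⟩
  obtain ⟨hXa, htda⟩ := isStrong_sup_and_td_eq_two hΓ hker hX ha
  obtain ⟨hXc, htdc⟩ := isStrong_sup_and_td_eq_two hΓ hker hX hc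
  exact HullIsoRel.snoc_of_append_single hXa hXc
    ((IsGammaIso.refl _ (Fin.append b u)).append_singleton htda htdc)

end Hgen

end System

end ZilberHomogeneity

/-! ### Assembly -/

section Assembly

open ZilberHomogeneity

/-- **Zilber fields are quasiminimal, granted `ℵ₀`-saturation for exponentially-algebraic
extensions** (Zilber 2005, Thm 1.2; Bays–Kirby 2018, Thm 9.1 = Thm 1.2, with Lemma 8.3 as the one
remaining input; the argument: Kirby 2010 (quasiminimal excellent classes) Lemma 5.1 with the
back-and-forth system `HullIsoRel` in place of automorphisms, as in Bays–Hart–Hyttinen–Kesälä–Kirby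
2014, Prop. 7.1): a countable structure is trivially quasiminimal; an uncountable Zilber field
carries the back-and-forth system of Γ-isomorphic strong hulls over `ℚτ`
(`isLocalIsoSystem_hullIsoRel`), under which all elements outside the countable set `ecl ⌈τ, b⌉`
correspond over `b` (`exists_countable_generic`), so
`IsLocalIsoSystem.countable_or_countable_compl` applies. The Γ-closedness of `ecl c` for finite
tuples `c` (Kirby 2010 EAEF Thm 1.2) is `GammaField.isGammaClosed_span_ecl_of_countable`
(any universe, under the countable closure property).
[cite: Zilber2005PseudoExp, Thm 1.2] [cite: BaysKirby2018ANT, Thm 9.1 and Lemma 8.3]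
[cite: Kirby2010QMEC, Lemma 5.1] -/
theorem IsZilberField.isQuasiminimal_of_saturation
    (hSat : BaysKirby2018_saturation_of_isStronglyExpAlgClosed.{u}) :
    IsZilberField.isQuasiminimal.{u} := by
  intro K _ _ _ hK s hs
  by_cases hc : Countable K
  · exact Or.inl s.to_countable
  · haveI : Uncountable K := ⟨hc⟩
    obtain ⟨τ, hτ, hker⟩ := hK.hasStandardKernel
    have hΓ : ∀ {N : ℕ} (c : Fin N → K), IsGammaClosed (Submodule.span ℚ (ecl (range c))) :=
      fun c => GammaField.isGammaClosed_span_ecl_of_countable hK.hasCountableClosureProperty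
        (countable_range c)
    exact (isLocalIsoSystem_hullIsoRel hSat hΓ hK hτ hker).countable_or_countable_compl
      (fun b => exists_countable_generic hΓ hK hker b) hs

/-- The same with the Γ-closedness of all `ecl C` as an explicit hypothesis
(`Kirby2010_isGammaClosed_ecl`, not needed any more; kept for the record).
[cite: Zilber2005PseudoExp, Thm 1.2] -/
theorem IsZilberField.isQuasiminimal_of_saturation_of_isGammaClosed
    (hSat : BaysKirby2018_saturation_of_isStronglyExpAlgClosed.{u})
    (_hΓ : Kirby2010_isGammaClosed_ecl.{u}) : IsZilberField.isQuasiminimal.{u} :=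
  IsZilberField.isQuasiminimal_of_saturation hSat

/-- Zilber fields in `Type` are quasiminimal, granted `ℵ₀`-saturation for
exponentially-algebraic extensions (the case `u = 0` of `isQuasiminimal_of_saturation`).
[cite: Zilber2005PseudoExp, Thm 1.2] [cite: BaysKirby2018ANT, Thm 9.1 and Lemma 8.3] -/
theorem IsZilberField.isQuasiminimal₀_of_saturation
    (hSat : BaysKirby2018_saturation_of_isStronglyExpAlgClosed.{0}) :
    IsZilberField.isQuasiminimal.{0} :=
  IsZilberField.isQuasiminimal_of_saturation hSat

end Assembly

end Literature.NumberTheory.Transcendental
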